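import Summits.ResolutionOfSingularities.ResolutionOfSingularities.Theorems.HilbertSamuelEliminationCampaignW42VertexGame
import Summits.ResolutionOfSingularities.ResolutionOfSingularities.Theorems.HilbertSamuelEliminationCampaignW42VertexGameRank
import Summits.ResolutionOfSingularities.ResolutionOfSingularities.Theorems.HilbertSamuelEliminationCampaignW42VertexGameTermination
import Mathlib.Data.Prod.Lex
import Mathlib.Data.Fintype.Fin
import Mathlib.Order.WellFounded

/-!
# [OURS · L1 W4.2] The vertex game at ALL closed points of the exceptional fibres («unit-forgetting»)
# (proof file 3 for `…CampaignW42VertexGame.lean`; `--supports stmt-ResolutionOfSingularities-19965`)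

HONEST FRAMING. OURS (seat res-L1-s42-pv-2, slot W4.2 / obstruction O2); nothing here is a statement of H. Hironaka's
manuscript [Hironaka2017]; AI-made, AI review is weaker than expert review. A theorem about the validated combinatorial
MODEL of the CJS walk on binomial threefolds, not about schemes; the O2 items 19964/19965 and the CORE stay OPEN.

WHAT IS ADDED. `…VertexGameTermination.lean` follows the walk into the torus-fixed closed points of the exceptional fibre
(the chart origins). A general closed point of the fibre over the tracked point lies in a chart `c ∈ U` with some of the
other centre coordinates `J ⊆ U ∖ {c}` invertible there; in the model (CALIBRATION-W42-O2-v2 §3d, fourth assumption: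
«non-fixed points = units forgotten») the local equation is `y^m + (unit) · x^{a''}` with `a'' =` the chart-origin exponents
with the coordinates in `J` FORGOTTEN (set to `0`), and the CJS bookkeeping rule is unchanged. This file types that larger
move relation `StepF ⊇ Step` and proves that it, too, admits no infinite play (`labelStrategyWinsF`, `0 < m`) — the Lean
twin of the full z3 certificate kit j272088 (which ranges over all `(U, c, J)`). Forgetting only lowers exponents, but it
changes which components pass through the point, hence which labels are oldest; the proof shows that an END move with
forgetting behaves like an END move (same first key, or death), and that an arrangement move whose survivor `U ∖ {c}`
would stay big admits no forgetting at all (`J = ∅`), so the chart-origin analysis applies verbatim.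
-/

set_option linter.dupNamespace false -- mandated namespace of this single-conjunct summit

namespace Summit.ResolutionOfSingularities.ResolutionOfSingularities.Theorems

namespace CampaignW42.VertexGame

open Finset

variable {m : ℕ}

/-- [OURS · L1 W4.2] Forgetting the coordinates in `J` (they are units at the point): their exponents become `0`.
[folklore] -/
def forget (a : Fin 3 → ℕ) (J : Finset (Fin 3)) : Fin 3 → ℕ :=
  fun i => if i ∈ J then 0 else a i

/-- [OURS · L1 W4.2] One move of the game followed into an ARBITRARY closed point of the exceptional fibre: a CJS
centre `U`, a chart `c ∈ U`, a set `J ⊆ U ∖ {c}` of centre coordinates that are units at the point, the transformed-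
then-forgotten exponents, and the CJS bookkeeping on the components of the new position. `J = ∅` is `Step`. [folklore] -/
def StepF (m : ℕ) (s s' : State) : Prop :=
  ∃ (isEnd : Bool) (U : Finset (Fin 3)) (c : Fin 3) (J : Finset (Fin 3)), IsCentre m s isEnd U ∧ c ∈ U ∧
    J ⊆ U.erase c ∧ s'.a = forget (transform m s.a U c) J ∧
    ∀ S ∈ comps m s'.a, s'.lab S = newLabel m s isEnd U c S

/-- [OURS · L1 W4.2] «The CJS label strategy wins at every closed point of the exceptional fibres»: no infinite play of
`StepF m`. Replaces the role of the CORE row / items 19964, 19965 ON THE BINOMIAL FAMILY at all closed points (model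
assumption «units forgotten»); NOT a statement of the manuscript. Proved for `0 < m` (`labelStrategyWinsF`). [folklore] -/
def LabelStrategyWinsF (m : ℕ) : Prop :=
  WellFounded (flip (StepF m))

/-! ## Forgetting: sums and components -/

/-- Forgetting nothing. [folklore] -/
theorem forget_empty (a : Fin 3 → ℕ) : forget a ∅ = a := by
  funext i; simp [forget]

/-- Chart-origin moves are moves. [folklore] -/
theorem stepF_of_step {s s' : State} (h : Step m s s') : StepF m s s' := by
  obtain ⟨isEnd, U, c, hcen, hcU, ha, hlab⟩ := h
  exact ⟨isEnd, U, c, ∅, hcen, hcU, empty_subset _, by rw [forget_empty]; exact ha, hlab⟩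

/-- Forgotten sums split: `Σ_S (forget a J) + Σ_{S ∩ J} a = Σ_S a`. [folklore] -/
theorem sum_forget_add (a : Fin 3 → ℕ) (S J : Finset (Fin 3)) :
    ∑ i ∈ S, forget a J i + ∑ i ∈ S ∩ J, a i = ∑ i ∈ S, a i := by
  rw [← Finset.sum_inter_add_sum_sdiff S J (forget a J), ← Finset.sum_inter_add_sum_sdiff S J a]
  have h1 : ∑ i ∈ S ∩ J, forget a J i = 0 :=
    Finset.sum_eq_zero fun i hi => by simp [forget, (mem_inter.1 hi).2]
  have h2 : ∑ i ∈ S \ J, forget a J i = ∑ i ∈ S \ J, a i :=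
    Finset.sum_congr rfl fun i hi => by simp [forget, (mem_sdiff.1 hi).2]
  omega

/-- Forgetting lowers sums. [folklore] -/
theorem sum_forget_le (a : Fin 3 → ℕ) (S J : Finset (Fin 3)) : ∑ i ∈ S, forget a J i ≤ ∑ i ∈ S, a i := by
  have := sum_forget_add a S J; omega

/-- Sums over index sets avoiding `J` are unchanged. [folklore] -/
theorem sum_forget_of_disjoint {a : Fin 3 → ℕ} {S J : Finset (Fin 3)} (h : Disjoint S J) :
    ∑ i ∈ S, forget a J i = ∑ i ∈ S, a i := by
  have := sum_forget_add a S J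
  rw [disjoint_iff_inter_eq_empty.1 h, sum_empty] at this
  omega

/-- A component after forgetting avoids the forgotten coordinates (for `0 < m`) and was a component before. [folklore] -/
theorem mem_comps_of_mem_comps_forget (hm : 0 < m) {b : Fin 3 → ℕ} {J W : Finset (Fin 3)}
    (hW : W ∈ comps m (forget b J)) : Disjoint W J ∧ W ∈ comps m b := by
  obtain ⟨hne, hbig, hsmall⟩ := mem_comps.1 hW
  have hdis : Disjoint W J := by
    rw [Finset.disjoint_left]
    intro x hxW hxJ
    have hx0 : forget b J x = 0 := by simp [forget, hxJ]
    have hsplit := (add_sum_erase W (forget b J) hxW).symm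
    rcases (W.erase x).eq_empty_or_nonempty with he | hne'
    · rw [he, sum_empty] at hsplit; omega
    · have := hsmall (W.erase x) (erase_ssubset hxW) hne'; omega
  refine ⟨hdis, mem_comps_of hne (by rwa [sum_forget_of_disjoint hdis] at hbig) fun T hT hTne => ?_⟩
  have := hsmall T hT hTne
  rwa [sum_forget_of_disjoint (hdis.mono_left hT.1)] at this

/-! ## (L1) with forgetting -/

/-- **(L1, all closed points)** After any `StepF` move (`0 < m`) the new position is `Good`. [folklore] -/
theorem good_of_stepF (hm : 0 < m) {s s' : State} (h : StepF m s s') : Good m s' := by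
  rintro ⟨⟨S, hS, T, hT, hST⟩, hcov⟩
  obtain ⟨isEnd, U, c, J, hcen, hcU, hJ, ha, hlab⟩ := h
  obtain ⟨R, hR, hcR⟩ := hcov c
  have hRc' : R ∈ comps m s'.a := mem_comps_of_mem_leastClass hR
  have key : ∀ W ∈ leastClass m s', c ∈ W := by
    intro W hW
    by_contra hcW
    have hWc' : W ∈ comps m s'.a := mem_comps_of_mem_leastClass hW
    have hWc : W ∈ comps m s.a :=
      mem_comps_of_mem_comps_transform hcW (mem_comps_of_mem_comps_forget hm (ha ▸ hWc')).2
    have hlabW : s'.lab W = s.lab W := by rw [hlab W hWc']; simp [newLabel, hcW]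
    have heq : s'.lab W = s'.lab R :=
      le_antisymm ((mem_leastClass.1 hW).2 R hRc') ((mem_leastClass.1 hR).2 W hWc')
    by_cases hcase : isEnd = true ∧ R ⊆ U
    · have hlabR : s'.lab R = s.lab U := by
        rw [hlab R hRc']; simp [newLabel, hcR, hcase.1, hcase.2]
      obtain ⟨hE, hRU⟩ := hcase
      subst hE
      cases hcen with
      | end_ S₀ hLC =>
        have hU : U ∈ leastClass m s := by rw [hLC]; exact mem_singleton_self _
        have hWL : W ∈ leastClass m s := mem_leastClass_of_lab_eq hU hWc (by rw [← hlabW, heq, hlabR])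
        rw [hLC, mem_singleton] at hWL
        exact hcW (hWL ▸ hcU)
    · have hlabR : s'.lab R = fresh m s := by
        rw [hlab R hRc']
        simp only [newLabel, hcR, not_true_eq_false, if_false]
        rw [if_neg hcase]
      have hlt := lab_lt_fresh hWc
      rw [← hlabW, heq, hlabR] at hlt
      exact lt_irrefl _ hlt
  exact Finset.disjoint_left.1 hST (key S hS) (key T hT)

/-! ## (L2) with forgetting — END moves -/

/-- END move on the single oldest component `U` into chart `c ∈ U`, forgetting `J ⊆ U ∖ {c}`: the rank drops
(`0 < m`). [folklore] -/
theorem rank_lt_of_stepF_end (hm : 0 < m) {s s' : State} {U J : Finset (Fin 3)} {c : Fin 3}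
    (hLC : leastClass m s = {U}) (hcU : c ∈ U) (hJ : J ⊆ U.erase c)
    (ha : s'.a = forget (transform m s.a U c) J)
    (hlab : ∀ S ∈ comps m s'.a, s'.lab S = newLabel m s true U c S) : rank m s' < rank m s := by
  have hU : U ∈ leastClass m s := by rw [hLC]; exact mem_singleton_self _
  have hUc : U ∈ comps m s.a := mem_comps_of_mem_leastClass hU
  have hbig : m ≤ ∑ i ∈ U, s.a i := le_sum_of_mem_comps hUc
  have hsplit : ∑ i ∈ U, s.a i = s.a c + ∑ i ∈ U.erase c, s.a i := (add_sum_erase U s.a hcU).symm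
  have hr : ∑ i ∈ U.erase c, s.a i < m := sum_lt_of_ssubset' hm hUc (erase_ssubset hcU)
  have harr : arr0 m s = 1 := by simp [arr0, hLC]
  have hexc : exc0 m s = ∑ i ∈ U, s.a i - m := by simp [exc0, hLC]
  have hrho : rho1 m s = total s.a - (∑ i ∈ U, s.a i - m) := by simp [rho1, harr, hexc]
  have hcJ : c ∉ J := fun h => notMem_erase c U (hJ h)
  have hJU : J ⊆ U := hJ.trans (erase_subset c U)
  -- the chart-origin exponents `b` and the forgotten ones `s'.a`
  set b := transform m s.a U c with hbdef
  have htot := total_transform (m := m) (a := s.a) (c := c) hbig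
  rw [← hbdef] at htot
  have hbU : ∑ i ∈ U, b i + m = ∑ i ∈ U, s.a i + ∑ i ∈ U.erase c, s.a i := sum_transform_of_mem hcU hbig
  have hbJ : ∑ i ∈ J, b i = ∑ i ∈ J, s.a i := sum_transform_of_not_mem hcJ
  have htot' : total s'.a + ∑ i ∈ J, b i = total b := by
    have := sum_forget_add b univ J; rw [univ_inter] at this; rw [ha]; exact this
  have hU' : ∑ i ∈ U, s'.a i + ∑ i ∈ J, b i = ∑ i ∈ U, b i := by
    have := sum_forget_add b U J
    rw [inter_eq_right.2 hJU] at this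
    rw [ha]; exact this
  have hJle : ∑ i ∈ J, s.a i ≤ ∑ i ∈ U.erase c, s.a i := sum_le_sum_of_subset hJ
  have hUle : ∑ i ∈ U, s.a i ≤ total s.a := sum_le_total _ _
  have hlabU' : ∀ hUc' : U ∈ comps m s'.a, s'.lab U = s.lab U := fun hUc' => by
    rw [hlab U hUc']; simp [newLabel, hcU]
  rw [rank_lt_iff]
  by_cases hpers : m ≤ ∑ i ∈ U, s'.a i
  · -- `U` persists and stays the single oldest component
    have hUc' : U ∈ comps m s'.a := by
      refine mem_comps_of (nonempty_of_mem_comps hUc) hpers fun T hT hTne => ?_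
      refine lt_of_le_of_lt (ha ▸ sum_forget_le b T J) ?_
      by_cases hcT : c ∈ T
      · have h1 : ∑ i ∈ T, b i + m = ∑ i ∈ U, s.a i + ∑ i ∈ T.erase c, s.a i := sum_transform_of_mem hcT hbig
        have h2 : ∑ i ∈ T, s.a i < m := sum_lt_of_ssubset hUc hT hTne
        have h3 : ∑ i ∈ T, s.a i = s.a c + ∑ i ∈ T.erase c, s.a i := (add_sum_erase T s.a hcT).symm
        omega
      · rw [sum_transform_of_not_mem hcT]; exact sum_lt_of_ssubset hUc hT hTne
    have hLC' : leastClass m s' = {U} := by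
      ext W
      simp only [mem_singleton]
      constructor
      · intro hW
        have hWc' := mem_comps_of_mem_leastClass hW
        by_contra hne
        have hle : s'.lab W ≤ s'.lab U := (mem_leastClass.1 hW).2 U hUc'
        rw [hlabU' hUc'] at hle
        by_cases hcW : c ∈ W
        · have hWf : s'.lab W = fresh m s := by
            rw [hlab W hWc']
            simp only [newLabel, hcW, not_true_eq_false, if_false, true_and]
            rw [if_neg]
            exact fun hWU => hne (eq_of_subset_of_mem_comps hUc' hWc' hWU)
          have := lab_lt_fresh hUc
          omega
        · have hWc : W ∈ comps m s.a :=
            mem_comps_of_mem_comps_transform hcW (mem_comps_of_mem_comps_forget hm (ha ▸ hWc')).2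
          have hWL : W ∉ leastClass m s := by rw [hLC, mem_singleton]; exact hne
          have := lab_lt_of_not_mem_leastClass hU hWc hWL
          have hlabW : s'.lab W = s.lab W := by rw [hlab W hWc']; simp [newLabel, hcW]
          omega
      · rintro rfl
        refine mem_leastClass.2 ⟨hUc', fun T hT => ?_⟩
        rw [hlabU' hUc', hlab T hT]
        by_cases hcT : c ∈ T
        · simp only [newLabel, hcT, not_true_eq_false, if_false, true_and]
          split_ifs with hTU
          · exact le_rfl
          · exact le_of_lt (lab_lt_fresh hUc)
        · simp only [newLabel, hcT, not_false_eq_true, if_true]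
          exact (mem_leastClass.1 hU).2 T
            (mem_comps_of_mem_comps_transform hcT (mem_comps_of_mem_comps_forget hm (ha ▸ hT)).2)
    have harr' : arr0 m s' = 1 := by simp [arr0, hLC']
    have hexc' : exc0 m s' = ∑ i ∈ U, s'.a i - m := by simp [exc0, hLC']
    have hrho' : rho1 m s' = total s'.a - (∑ i ∈ U, s'.a i - m) := by simp [rho1, harr', hexc']
    have hUle' : ∑ i ∈ U, s'.a i ≤ total s'.a := sum_le_total _ _
    right
    exact ⟨by omega, Or.inr ⟨by omega, by omega⟩⟩
  · -- `U` dies: `rho1` drops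
    left
    have := rho1_le_total (m := m) (s := s')
    omega

/-! ## (L2) with forgetting — arrangement moves -/

/-- Arrangement move from a `Good` position into chart `c`, forgetting `J ⊆ U ∖ {c}`: the rank drops (`0 < m`). Either
the order drops, or nothing can be forgotten (`J = ∅`) and the chart-origin analysis applies. [folklore] -/
theorem rank_lt_of_stepF_arr (hm : 0 < m) {s s' : State} (hG : Good m s) {sub : Finset (Finset (Fin 3))}
    {J : Finset (Fin 3)} {c : Fin 3} (hsub : sub ⊆ leastClass m s) (hcard : 2 ≤ sub.card)
    (hcU : c ∈ sub.biUnion id) (hJ : J ⊆ (sub.biUnion id).erase c)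
    (ha : s'.a = forget (transform m s.a (sub.biUnion id) c) J)
    (hlab : ∀ S ∈ comps m s'.a, s'.lab S = newLabel m s false (sub.biUnion id) c S) :
    rank m s' < rank m s := by
  set U := sub.biUnion id with hUdef
  by_cases hR : m + ∑ i ∈ J, s.a i ≤ ∑ i ∈ U.erase c, s.a i
  · -- nothing can be forgotten: `J = ∅`
    obtain ⟨hRcomp, -⟩ := arr_survivor hG hsub hcard hcU (le_trans (Nat.le_add_right _ _) hR)
    rw [← hUdef] at hRcomp
    have hJe : J = ∅ := by
      rw [eq_empty_iff_forall_notMem]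
      intro x hxJ
      have hxR : x ∈ U.erase c := hJ hxJ
      have h1 : ∑ i ∈ (U.erase c).erase x, s.a i < m := sum_lt_of_ssubset' hm hRcomp (erase_ssubset hxR)
      have h2 := (add_sum_erase (U.erase c) s.a hxR).symm
      have h3 : s.a x ≤ ∑ i ∈ J, s.a i := single_le_sum (fun _ _ => Nat.zero_le _) hxJ
      omega
    subst hJe
    rw [forget_empty] at ha
    exact rank_lt_of_step_arr hG hsub hcard hcU ha hlab
  · -- the order drops
    rw [not_le] at hR
    obtain ⟨S1, hS1, -, -, -⟩ := (Finset.one_lt_card (s := sub)).1 (by omega)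
    have hS1c := mem_comps_of_mem_leastClass (hsub hS1)
    have harr : 2 ≤ arr0 m s := le_trans hcard (card_le_card hsub)
    have hrho : rho1 m s = total s.a := by
      have : arr0 m s ≠ 1 := by omega
      simp [rho1, this]
    have hbigU : m ≤ ∑ i ∈ U, s.a i :=
      le_trans (le_sum_of_mem_comps hS1c) (sum_le_sum_of_subset (subset_biUnion_of_mem id hS1))
    have hcJ : c ∉ J := fun h => notMem_erase c U (hJ h)
    set b := transform m s.a U c with hbdef
    have htot := total_transform (m := m) (a := s.a) (c := c) hbigU
    rw [← hbdef] at htot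
    have hbJ : ∑ i ∈ J, b i = ∑ i ∈ J, s.a i := sum_transform_of_not_mem hcJ
    have htot' : total s'.a + ∑ i ∈ J, b i = total b := by
      have := sum_forget_add b univ J; rw [univ_inter] at this; rw [ha]; exact this
    have hsplit : ∑ i ∈ U, s.a i = s.a c + ∑ i ∈ U.erase c, s.a i := (add_sum_erase U s.a hcU).symm
    have hrho'le := rho1_le_total (m := m) (s := s')
    rw [rank_lt_iff, hrho]
    left; omega

/-! ## Assembly -/

/-- **(L2, all closed points)** From a `Good` position every `StepF` move strictly lowers the rank (`0 < m`).
[folklore] -/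
theorem rank_lt_of_stepF (hm : 0 < m) {s s' : State} (hG : Good m s) (h : StepF m s s') :
    rank m s' < rank m s := by
  obtain ⟨isEnd, U, c, J, hcen, hcU, hJ, ha, hlab⟩ := h
  cases hcen with
  | end_ S₀ hLC => exact rank_lt_of_stepF_end hm hLC hcU hJ ha hlab
  | arr sub hsub hcard => exact rank_lt_of_stepF_arr hm hG hsub hcard hcU hJ ha hlab

/-- `Good` positions are `StepF`-accessible. [folklore] -/
theorem accF_of_good (hm : 0 < m) : ∀ s : State, Good m s → Acc (flip (StepF m)) s := by
  suffices h : ∀ (r : ℕ ×ₗ ℕ ×ₗ ℕ) (s : State), rank m s = r → Good m s → Acc (flip (StepF m)) s from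
    fun s hs => h _ s rfl hs
  intro r
  induction r using WellFoundedLT.induction with
  | ind r ih =>
    intro s hr hs
    exact Acc.intro s fun s' hs' =>
      ih (rank m s') (hr ▸ rank_lt_of_stepF hm hs hs') s' rfl (good_of_stepF hm hs')

/-- **[OURS · L1 W4.2] The CJS label strategy wins the one-vertex polyhedra game in dimension 3 at every closed point
of the exceptional fibres**: for `0 < m` there is no infinite play of `StepF m`. A theorem about the validated model
(«units forgotten» at non-fixed points), NOT about schemes, NOT a statement of the manuscript. [folklore] -/
theorem labelStrategyWinsF (hm : 0 < m) : LabelStrategyWinsF m :=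
  ⟨fun s => Acc.intro s fun s' hs' => accF_of_good hm s' (good_of_stepF hm hs')⟩

/-- The all-points statement implies the chart-origin one. [folklore] -/
theorem labelStrategyWins_of_winsF (h : LabelStrategyWinsF m) : LabelStrategyWins m :=
  Subrelation.wf (fun hst => stepF_of_step hst) h

/-- Corollary: no infinite play through arbitrary closed points of the exceptional fibres. [folklore] -/
theorem no_infinite_playF (hm : 0 < m) (f : ℕ → State) : ¬ ∀ n, StepF m (f n) (f (n + 1)) := fun hf => by
  have key : ∀ s, Acc (flip (StepF m)) s → ∀ n, f n ≠ s := by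
    intro s hacc
    induction hacc with
    | intro s _ ih => intro n hn; exact ih (f (n + 1)) (hn ▸ hf n) (n + 1) rfl
  exact key (f 0) ((labelStrategyWinsF hm).apply (f 0)) 0 rfl

end CampaignW42.VertexGame

end Summit.ResolutionOfSingularities.ResolutionOfSingularities.Theorems
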